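import Mathlib
import Literature.AlgebraicGeometry.Resolution.KummerNormalForm
import Literature.AlgebraicGeometry.Resolution.GiraudNormalFormTransport
import Literature.AlgebraicGeometry.Resolution.ProjectiveSpaceRegular
import Literature.AlgebraicGeometry.Resolution.RegularSystemOfParameters
import Summits.ResolutionOfSingularities.ResolutionOfSingularities.Theorems.PicoverLocalModel.Negative.PowerDichotomy

/-!
# Crux `PicoverLocalModel` (stmt-ResolutionOfSingularities-0557), line `SketchIdeator3`
# (giraud-cossart-normal-form) — stub `stub_specCurveNormalForm`

The scheme-plumbing part (C) of the dimension `≤ 1` case of the residue: for `R` a regular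
domain of Krull dimension `≤ 1`, `a ∈ R` and a finite set `S` of non-zero primes such that the
image of `a` in `R_q` is in Giraud normal form with EMPTY boundary at every `q ∉ S` and with
boundary a uniformizer of `R_q` at every `q ∈ S`, NO modification is needed: `W = Spec R`,
`π = 𝟙` and `E` = the ideal sheaves of the (closed: `dim R ≤ 1`) points of `S` satisfy
`IsProper π ∧ IsBirational π ∧ IsIntegral W ∧ Scheme.IsRegular W ∧ HasSNC E ∧
InGiraudNormalForm p W π a E`.

Contents (all folklore, proved):
* `giraudNormalFormAt_map_ringEquiv` — the intrinsic Giraud normal form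
  (`Literature.AlgebraicGeometry.Resolution.GiraudNormalFormAt`) is transported along
  isomorphisms of local rings;
* `mem_support_ofIdealTop_iff`, `stalkIdeal_ofIdealTop_eq`, `stalkIdeal_ofIdealTop_self` — the
  ideal sheaf `Scheme.IdealSheafData.ofIdealTop (J · Γ(Spec R, ⊤))` of an ideal `J ⊆ R` has
  support `V(J)` and stalk `J R_x` at `x`, the maximal ideal at `x = J` prime;
* `exists_ringEquiv_stalk` — `R_x ≅ 𝒪_{Spec R, x}` compatibly with the germs of global sections;
* `stub_specCurveNormalForm` — the registered stub: at `q ∈ S` the stalk is a DVR (`R` is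
  Dedekind: Noetherian, normal since regular, of dimension `≤ 1`), so `emb dim = 1` and the only
  member of `E` through `q` has stalk `𝔪_q`; off `S` no member of `E` passes; the two normal-form
  hypotheses are transported from `R_w` to the stalks.
-/

noncomputable section

-- single-problem summit: the doubled namespace component `ResolutionOfSingularities` is the tree layout
set_option linter.dupNamespace false

open CategoryTheory CategoryTheory.Limits AlgebraicGeometry TopologicalSpace Polynomial
open Literature.AlgebraicGeometry.Resolution

namespace Summit.ResolutionOfSingularities.ResolutionOfSingularities.Theorems.PicoverLocalModel.SpecCurveNormalForm

/-! ## Transport of the Giraud normal form along an isomorphism of local rings -/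

section Transport

variable {O O' : Type*} [CommRing O] [IsLocalRing O] [CommRing O'] [IsLocalRing O'] {p : ℕ}

/-- An isomorphism of local rings carries `𝔪² + (x)` onto `𝔪'² + (e x)`. [folklore] -/
theorem map_sq_sup_span_range (e : O ≃+* O') {r : ℕ} (x : Fin r → O) :
    (IsLocalRing.maximalIdeal O ^ 2 ⊔ Ideal.span (Set.range x)).map e =
      IsLocalRing.maximalIdeal O' ^ 2 ⊔ Ideal.span (Set.range fun i => e (x i)) := by
  rw [Ideal.map_sup, Ideal.map_pow, IsLocalRing.map_ringEquiv_maximalIdeal, Ideal.map_span,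
    ← Set.range_comp]
  rfl

/-- The wound-or-transversal condition is invariant under isomorphisms of local rings.
[folklore] -/
theorem isWoundOrTransversalAt_map_ringEquiv (e : O ≃+* O') {r : ℕ} {x : Fin r → O} {u : O}
    (hu : IsWoundOrTransversalAt p x u) :
    IsWoundOrTransversalAt p (fun i => e (x i)) (e u) := by
  have hunit : ∀ y : O, e y ∈ IsLocalRing.maximalIdeal O' ↔ y ∈ IsLocalRing.maximalIdeal O := by
    intro y
    rw [IsLocalRing.mem_maximalIdeal, IsLocalRing.mem_maximalIdeal, mem_nonunits_iff,
      mem_nonunits_iff, MulEquiv.isUnit_map]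
  rcases hu with hw | ⟨c, hc, hc2⟩
  · refine Or.inl fun c' h => hw (e.symm c') ?_
    rw [← hunit, map_sub, map_pow, e.apply_symm_apply]
    exact h
  · refine Or.inr ⟨e c, ?_, fun h => hc2 ?_⟩
    · rw [← map_pow, ← map_sub, hunit]
      exact hc
    · rw [← map_pow, ← map_sub, ← map_sq_sup_span_range e x, Ideal.apply_mem_of_equiv_iff] at h
      exact h

/-- **The Giraud normal form is invariant under isomorphisms of local rings** (units go to
units, the maximal ideal to the maximal ideal, powers and products are preserved). [folklore] -/
theorem giraudNormalFormAt_map_ringEquiv (e : O ≃+* O') {r : ℕ} {x : Fin r → O} {a : O}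
    (h : GiraudNormalFormAt p x a) : GiraudNormalFormAt p (fun i => e (x i)) (e a) := by
  rcases h with ⟨g, u, B, hu, ha⟩ | ⟨g, A, v, hA, ha⟩
  · refine Or.inl ⟨e g, e u, B, isWoundOrTransversalAt_map_ringEquiv e hu, ?_⟩
    rw [ha]
    simp [map_add, map_mul, map_pow, map_prod]
  · refine Or.inr ⟨e g, A, Units.map (e : O →* O') v, hA, ?_⟩
    rw [ha]
    simp [map_add, map_mul, map_pow, map_prod, Units.coe_map]

end Transport

/-! ## The ideal sheaf of a closed point of `Spec R` -/

section PointIdeal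

variable {R : Type} [CommRing R]

/-- The support of the ideal sheaf on `Spec R` of an ideal `J ⊆ R` is `V(J)`. [folklore] -/
theorem mem_support_ofIdealTop_iff (J : Ideal R) (x : Spec (.of R)) :
    x ∈ (Scheme.IdealSheafData.ofIdealTop
        (J.map (Scheme.ΓSpecIso (.of R)).inv.hom) : (Spec (.of R)).IdealSheafData).support ↔
      J ≤ x.asIdeal := by
  rw [← SetLike.mem_coe, Scheme.IdealSheafData.coe_support_ofIdealTop, Ideal.map,
    Scheme.zeroLocus_span]
  change x ∈ (Spec (.of R)).zeroLocus ((Scheme.ΓSpecIso (.of R)).inv '' (J : Set R)) ↔ _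
  rw [Spec_zeroLocus_eq_zeroLocus]
  change (J : Set R) ⊆ x.asIdeal ↔ _
  exact SetLike.coe_subset_coe

/-- The stalk at `x` of the ideal sheaf on `Spec R` of an ideal `J ⊆ R` is the extension of `J`
along `R → 𝒪_{Spec R, x} = R_x`. [folklore] -/
theorem stalkIdeal_ofIdealTop_eq (J : Ideal R) (x : Spec (.of R)) :
    letI : Algebra R ((Spec (.of R)).presheaf.stalk x) := StructureSheaf.stalkAlgebra R x
    stalkIdeal (Scheme.IdealSheafData.ofIdealTop
        (J.map (Scheme.ΓSpecIso (.of R)).inv.hom) : (Spec (.of R)).IdealSheafData) x =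
      J.map (algebraMap R ((Spec (.of R)).presheaf.stalk x)) := by
  letI : Algebra R ((Spec (.of R)).presheaf.stalk x) := StructureSheaf.stalkAlgebra R x
  rw [stalkIdeal_eq_map_germ _ ⟨⊤, isAffineOpen_top _⟩ (Set.mem_univ x),
    Scheme.IdealSheafData.ofIdealTop_ideal, Ideal.map_map, Ideal.map_map]
  -- restriction along `⊤ ≤ ⊤` followed by the germ map, after `R ≅ Γ(Spec R, ⊤)`, is the
  -- structure map `R → R_x` of the stalk (definitionally)
  congr 1

/-- At the point `q` itself, the stalk of the ideal sheaf of the prime `q` is the maximal ideal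
of `𝒪_{Spec R, q} = R_q`. [folklore] -/
theorem stalkIdeal_ofIdealTop_self (q : Spec (.of R)) :
    stalkIdeal (Scheme.IdealSheafData.ofIdealTop
        (q.asIdeal.map (Scheme.ΓSpecIso (.of R)).inv.hom) : (Spec (.of R)).IdealSheafData) q =
      IsLocalRing.maximalIdeal ((Spec (.of R)).presheaf.stalk q) := by
  letI : Algebra R ((Spec (.of R)).presheaf.stalk q) := StructureSheaf.stalkAlgebra R q
  haveI : IsLocalization.AtPrime ((Spec (.of R)).presheaf.stalk q) q.asIdeal :=
    StructureSheaf.IsLocalization.to_stalk R q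
  rw [stalkIdeal_ofIdealTop_eq, IsLocalization.AtPrime.map_eq_maximalIdeal]

end PointIdeal

/-! ## The local rings of `Spec R` -/

section Stalks

variable {R : Type} [CommRing R]

/-- The local ring of `Spec R` at `x` is `R_x`: an isomorphism `R_x ≅ 𝒪_{Spec R, x}` carrying the
image of `r ∈ R` to the germ at `x` of the global section `r` (pulled back along the identity).
[folklore] -/
theorem exists_ringEquiv_stalk (x : PrimeSpectrum R) :
    ∃ e : Localization.AtPrime x.asIdeal ≃+* (Spec (.of R)).presheaf.stalk x,
      ∀ r : R, e (algebraMap R _ r) =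
        (Spec (.of R)).presheaf.germ ⊤ x trivial
          ((𝟙 (Spec (.of R)) : Spec (.of R) ⟶ Spec (.of R)).appTop
            ((Scheme.ΓSpecIso (.of R)).inv r)) := by
  letI : Algebra R ((Spec (.of R)).presheaf.stalk x) := StructureSheaf.stalkAlgebra R x
  haveI : IsLocalization.AtPrime ((Spec (.of R)).presheaf.stalk x) x.asIdeal :=
    StructureSheaf.IsLocalization.to_stalk R x
  exact ⟨(IsLocalization.algEquiv x.asIdeal.primeCompl (Localization.AtPrime x.asIdeal)
      ((Spec (.of R)).presheaf.stalk x)).toRingEquiv, fun r =>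
    (IsLocalization.algEquiv x.asIdeal.primeCompl (Localization.AtPrime x.asIdeal)
      ((Spec (.of R)).presheaf.stalk x)).commutes r⟩

end Stalks

/-! ## The stub -/

/-- STUB (`n ≤ 1`, C: scheme plumbing) of the line `SketchIdeator3` of crux
stmt-ResolutionOfSingularities-0557 — **Giraud normal form on a regular affine curve, no
modification needed.** Let `R` be a regular domain of Krull dimension `≤ 1`, `a ∈ R`, and `S` a
finite set of non-zero (hence closed) points of `Spec R` such that the image of `a` in `R_q` is in
Giraud normal form with empty boundary at every `q ∉ S` and with boundary a uniformizer `ϖ` of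
the discrete valuation ring `R_q` at every `q ∈ S`. Then `W = Spec R`, `π = 𝟙` and `E` = the
ideal sheaves of the points of `S` do: `π` is proper and birational, `W` is integral and regular,
`E` has simple normal crossings (at `q ∈ S` the local ring is a DVR, `emb dim = 1`, and the only
member of `E` through `q` has stalk `𝔪_q = (ϖ)`; elsewhere no member of `E` passes), and the
hypotheses, transported along `R_w ≅ 𝒪_{Spec R, w}`, are the Giraud normal form of the germ of
`a` at every point. [folklore] -/
theorem stub_specCurveNormalForm : ∀ (p : ℕ) (R : Type) [CommRing R] [IsDomain R],
    IsRegularRing R → ringKrullDim R ≤ 1 → ∀ (a : R) (S : Set (PrimeSpectrum R)), S.Finite →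
    (∀ q ∈ S, q.asIdeal ≠ ⊥) →
    (∀ q : PrimeSpectrum R, q ∉ S → GiraudNormalFormAt p
        (![] : Fin 0 → Localization.AtPrime q.asIdeal)
        (algebraMap R (Localization.AtPrime q.asIdeal) a)) →
    (∀ q ∈ S, ∀ ϖ : Localization.AtPrime q.asIdeal,
        IsLocalRing.maximalIdeal (Localization.AtPrime q.asIdeal) = Ideal.span {ϖ} →
        GiraudNormalFormAt p ![ϖ] (algebraMap R (Localization.AtPrime q.asIdeal) a)) →
      ∃ (W : Scheme.{0}) (π : W ⟶ Spec (.of R)) (E : List W.IdealSheafData),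
        IsProper π ∧ IsBirational π ∧ IsIntegral W ∧ Scheme.IsRegular W ∧ HasSNC E ∧
          InGiraudNormalForm p W π a E := by
  intro p R _ _ hreg hdim a S hS hS0 hgood hbad
  classical
  haveI := hreg
  haveI : Ring.KrullDimLE 1 R := Ring.krullDimLE_iff.mpr hdim
  haveI : IsIntegrallyClosed R := Negative.isIntegrallyClosed_of_isRegularRing R
  haveI : Ring.DimensionLEOne R := ⟨fun hne hp => hp.isMaximal_of_ne_bot hne⟩
  haveI : IsDedekindRing R := {}
  have hmax : ∀ q ∈ S, q.asIdeal.IsMaximal := fun q hq =>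
    q.isPrime.isMaximal_of_ne_bot (hS0 q hq)
  have hWreg : Scheme.IsRegular (Spec (.of R)) := Scheme.isRegular_Spec (.of R)
  -- the boundary: the ideal sheaves of the bad closed points
  obtain ⟨I, hI⟩ : ∃ I : PrimeSpectrum R → (Spec (.of R)).IdealSheafData, ∀ q, I q =
      Scheme.IdealSheafData.ofIdealTop (q.asIdeal.map (Scheme.ΓSpecIso (.of R)).inv.hom) :=
    ⟨_, fun q => rfl⟩
  have hsupp : ∀ (q : PrimeSpectrum R) (x : Spec (.of R)),
      x ∈ (I q).support ↔ q.asIdeal ≤ x.asIdeal := by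
    intro q x
    rw [hI]
    exact mem_support_ofIdealTop_iff q.asIdeal x
  have hstalk : ∀ q : PrimeSpectrum R, stalkIdeal (I q) q =
      IsLocalRing.maximalIdeal ((Spec (.of R)).presheaf.stalk q) := by
    intro q
    rw [hI]
    exact stalkIdeal_ofIdealTop_self q
  obtain ⟨E, hE⟩ : ∃ E : List (Spec (.of R)).IdealSheafData, E = hS.toFinset.toList.map I :=
    ⟨_, rfl⟩
  have hmemE : ∀ q ∈ S, I q ∈ E := fun q hq =>
    hE ▸ List.mem_map.mpr ⟨q, Finset.mem_toList.mpr (hS.mem_toFinset.mpr hq), rfl⟩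
  have hE' : ∀ D ∈ E, ∀ x : Spec (.of R), x ∈ D.support → x ∈ S ∧ D = I x := by
    intro D hD x hx
    rw [hE] at hD
    obtain ⟨q, hqL, rfl⟩ := List.mem_map.mp hD
    have hqS : q ∈ S := hS.mem_toFinset.mp (Finset.mem_toList.mp hqL)
    have hqx : q = x :=
      PrimeSpectrum.ext ((hmax q hqS).eq_of_le x.isPrime.ne_top ((hsupp q x).mp hx))
    refine ⟨hqx ▸ hqS, ?_⟩
    rw [← hqx]
  have hself : ∀ q ∈ S, (q : Spec (.of R)) ∈ (I q).support := fun q _ =>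
    (hsupp q q).mpr le_rfl
  have hnotTop : ∀ x : Spec (.of R), x ∉ (⊤ : (Spec (.of R)).IdealSheafData).support := by
    intro x h
    rw [Scheme.IdealSheafData.support_top, ← SetLike.mem_coe, TopologicalSpace.Closeds.coe_bot]
      at h
    exact h
  -- simple normal crossings
  have hSNC : HasSNC E := by
    intro x
    haveI := hWreg x
    obtain ⟨u, hu⟩ := exists_regularSystemOfParameters (R := (Spec (.of R)).presheaf.stalk x)
    refine ⟨hWreg x, u, hu, ?_, fun h => (hnotTop x h).elim⟩
    by_cases hx : x ∈ S
    · -- at a bad point the local ring is a DVR: `emb dim = 1`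
      have hd : (IsLocalRing.maximalIdeal ((Spec (.of R)).presheaf.stalk x)).spanFinrank = 1 := by
        obtain ⟨e, -⟩ := exists_ringEquiv_stalk (R := R) x
        haveI : IsDiscreteValuationRing (Localization.AtPrime x.asIdeal) :=
          IsLocalization.AtPrime.isDiscreteValuationRing_of_dedekind_domain R (hS0 x hx) _
        have h1 : ringKrullDim ((Spec (.of R)).presheaf.stalk x) = 1 := by
          rw [← ringKrullDim_eq_of_ringEquiv e]
          exact IsDiscreteValuationRing.ringKrullDim_eq_one _
        have h2 := IsRegularLocalRing.spanFinrank_maximalIdeal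
          (R := (Spec (.of R)).presheaf.stalk x)
        rw [h1] at h2
        exact_mod_cast h2
      let i₀ : Fin (IsLocalRing.maximalIdeal ((Spec (.of R)).presheaf.stalk x)).spanFinrank :=
        ⟨0, by rw [hd]; exact Nat.one_pos⟩
      have hall : ∀ i : Fin (IsLocalRing.maximalIdeal
          ((Spec (.of R)).presheaf.stalk x)).spanFinrank, i = i₀ := fun i =>
        Fin.ext (by have hi : (i : ℕ) < 1 := i.2.trans_eq hd; show i.val = 0; omega)
      refine ⟨fun _ => i₀, fun D₁ D₂ _ => Subtype.ext
        ((hE' D₁.1 D₁.2.1 x D₁.2.2).2.trans (hE' D₂.1 D₂.2.1 x D₂.2.2).2.symm), fun D => ?_⟩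
      rw [(hE' D.1 D.2.1 x D.2.2).2, hstalk x, ← hu]
      congr 1
      ext y
      simp only [Set.mem_range, Set.mem_singleton_iff]
      exact ⟨fun ⟨i, hi⟩ => by rw [← hi, hall i], fun hy => ⟨i₀, hy.symm⟩⟩
    · have hempty : ∀ D : {D : (Spec (.of R)).IdealSheafData // D ∈ E ∧ x ∈ D.support}, False :=
        fun D => hx (hE' D.1 D.2.1 x D.2.2).1
      exact ⟨fun D => (hempty D).elim, fun D => (hempty D).elim, fun D => (hempty D).elim⟩
  refine ⟨Spec (.of R), 𝟙 _, E, inferInstance, ⟨⊤, ?_, ?_, ?_⟩, inferInstance, hWreg, hSNC, ?_⟩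
  · simp
  · simp
  · infer_instance
  -- Giraud normal form at every point, transported from `R_w` to the stalk
  intro w
  obtain ⟨e, he⟩ := exists_ringEquiv_stalk (R := R) w
  by_cases hw : w ∈ S
  · haveI : IsDiscreteValuationRing (Localization.AtPrime w.asIdeal) :=
      IsLocalization.AtPrime.isDiscreteValuationRing_of_dedekind_domain R (hS0 w hw) _
    obtain ⟨ϖ, hϖ⟩ := IsDiscreteValuationRing.exists_irreducible (Localization.AtPrime w.asIdeal)
    rw [IsDiscreteValuationRing.irreducible_iff_uniformizer] at hϖ
    have hG := giraudNormalFormAt_map_ringEquiv e (hbad w hw ϖ hϖ)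
    rw [he] at hG
    refine ⟨1, fun _ => ⟨I w, hmemE w hw, hself w hw⟩, fun i => e ((![ϖ] : Fin 1 → _) i),
      ⟨fun i j _ => Subsingleton.elim i j,
        fun D => ⟨0, Subtype.ext (hE' D.1 D.2.1 w D.2.2).2.symm⟩⟩,
      fun j => ?_, hG⟩
    show stalkIdeal (I w) w = Ideal.span {e ((![ϖ] : Fin 1 → _) j)}
    rw [Matrix.cons_val_fin_one, hstalk w, ← IsLocalRing.map_ringEquiv_maximalIdeal e, hϖ,
      Ideal.map_span, Set.image_singleton]
  · have hempty : ∀ D : {D : (Spec (.of R)).IdealSheafData // D ∈ E ∧ w ∈ D.support}, False :=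
      fun D => hw (hE' D.1 D.2.1 w D.2.2).1
    have hG := giraudNormalFormAt_map_ringEquiv e (hgood w hw)
    rw [he] at hG
    exact ⟨0, fun i => i.elim0, fun i => e ((![] : Fin 0 → _) i),
      ⟨fun i => i.elim0, fun D => (hempty D).elim⟩, fun i => i.elim0, hG⟩

end Summit.ResolutionOfSingularities.ResolutionOfSingularities.Theorems.PicoverLocalModel.SpecCurveNormalForm

end
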